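import Summits.BirchSwinnertonDyer.BirchSwinnertonDyer.Theorems.Rank2Observatory2DescClCurveCertE2
import Summits.BirchSwinnertonDyer.BirchSwinnertonDyer.Theorems.Rank2Observatory2DescClRealCertE
import HarnessLib

/-!
# BirchSwinnertonDyer — rank ≥ 2 observatory: KERNEL-2DESC-CL v2.3 — the TWO-VIEW per-curve certificate (totally real case), part 1/2: records, checkers, entry lemmas

HONEST FRAMING: per-curve certified theorems and census instruments; no claim on BSD in rank ≥ 2.

Part 1 of 2 of the totally real two-view per-curve layer (split at the 400-line module cap; declaration text verbatim
from the single-file version).  The mechanism, for both parts: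
The totally real (`Δ(F) > 0`, `(r₁, r₂) = (3, 0)`, unit rank `2`) signature of the two-view per-curve layer
`…2DescClCurveCertE2`: the 2-division field `K` is NON-MONOGENIC at tier 0 and presented by two monogenic views
`ℤ[α]`, `ℤ[η]` of coprime index; every named element `x` is a TWO-VIEW ELEMENT (`X = m₁·x ∈ ℤ[α]`, `Y = m₂·x ∈ ℤ[η]`,
`m₁ = r₁²`, `gcd(m₁, m₂) = 1`), and all element-level lemmas (`eltOf`, `norm_eltOf`, `rho_eltOf`, the per-prime
dispatch `dispatch_sound`, `supp_of_famCheckE2`, `log_W₁/W₂_of_famCheckE2`) are those of the complex file.  What is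
specific here is v2.1's archimedean layer (`ClFieldCertR.checkArch`: three isolating intervals, `exists_rho_of_arch`,
`units_rank_of_arch`): three sign rows read on `X` (as `m₁ > 0`), the `θ_E`-order of the places read on `X_t`
(`lin_lt_lin`, then division by `m₁`), and the three-place sieve `admStd3RQ` (`admStd3R_sound`).  Records
`ClFieldCertRE2` (= `ClFieldCertRE` + `r₁, m₂` + Bezout, with `toE2`), `ClCurveCertE2R` (= `ClCurveCertE2` + the
sign table at `ρ₁, ρ₂` + the place order); checkers `famCheckE2R`, `checkE2R r`; soundness `rank_le_of_checkE2R`;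
`rank_eq_of_checkE2R`; `K`-free row shapes `rank_eq_of_certsE2R`, `rank_eq_of_certsE2R_complSq`.  New file only;
This part: the records `ClFieldCertRE2`, `ClCurveCertE2R`, the checkers `famCheckE2R`, `checkE2R r`, and the
entry-level real-place lemmas.  New declarations only.
[cite: Cassels1991LecturesEllipticCurves, §15] [cite: CremonaAlgorithms1997, §3.6] [cite: Cohen1993, §4.8.2, §6.2, §6.5]
[cite: Marcus2018, Ch. 5, Thm. 38] [cite: SilvermanAEC2009, X.1.1]
-/

set_option linter.dupNamespace false

noncomputable section

open Polynomial NumberField IsDedekindDomain Module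
open Literature.NumberTheory.NumberFields   -- OPENFIX (cert-1 gen 35): `MonicCubic.*` lives in this namespace; the line was missing (inlined-head prechecks leaked it from `…ClRealCertE`)

namespace Summit.BirchSwinnertonDyer.BirchSwinnertonDyer.Rank2Observatory.TwoDescCl

open TwoDescCubic ClFieldCert

/-! ## Records -/

/-- **Totally real two-view per-field record with the view multipliers**: v2.3's `ClFieldCertRE` (archimedean data of
the three places + the `η`-view) and `r₁` (`m₁ = r₁²`), `m₂`, Bezout `s, t`. -/
structure ClFieldCertRE2 where
  fre : ClFieldCertRE
  r₁ : ℕ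
  m₂ : ℕ
  s : ℤ
  t : ℤ

namespace ClFieldCertRE2

variable (G : ClFieldCertRE2)

/-- The signature-free two-view record with multipliers underneath (all element lemmas of the complex file apply to it). -/
def toE2 : ClFieldCertE2 := ⟨G.fre.toE, G.r₁, G.m₂, G.s, G.t⟩

/-- **The per-field checker**: v2.3's totally real two-view field checker and the constant clause of the multipliers.
Computable; `decide +kernel` once per field. -/
def check2R : Bool := G.fre.checkRE && G.toE2.checkConst

/-- The two-view real field clause of a checked record-with-multipliers. -/
theorem checkRE_of_check2R (h : G.check2R = true) : G.fre.checkRE = true := by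
  simp only [check2R, Bool.and_eq_true] at h; exact h.1

/-- The multiplier/Bezout clause of a checked real record-with-multipliers. -/
theorem const_of_check2R (h : G.check2R = true) : G.toE2.checkConst = true := by
  simp only [check2R, Bool.and_eq_true] at h; exact h.2

/-- The archimedean clause of a checked real record-with-multipliers. -/
theorem checkArch_of_check2R (h : G.check2R = true) : G.fre.re.checkArch = true :=
  G.fre.checkArch_of_checkRE (G.checkRE_of_check2R h)

/-- The two-view core clause of a checked real record-with-multipliers. -/
theorem checkCoreE_of_check2R (h : G.check2R = true) : G.toE2.fe.checkCoreE = true :=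
  G.fre.checkCoreE_of_checkRE (G.checkRE_of_check2R h)

/-- The complex-shape view `toE2` has field part `fre.toE` (definitional). -/
theorem toE2_fe : G.toE2.fe = G.fre.toE := rfl

/-- The `α`-view base of `toE2` is the v2.1 registry core (definitional). -/
theorem toE2_base : G.toE2.fe.base = G.fre.re.core := rfl

end ClFieldCertRE2

/-- **Totally real two-view per-curve record**: the two-view curve record `cc` (whose `head` now lists the FIVE
field-level family elements `−1, ε₁, ε₂, γ, q`), the sign bits at `ρ₁, ρ₂` of every family element keyed by its
`α`-view coordinates `X` (the bit at `ρ₀` is the entry's own `sg`), and the `θ_E`-order `o₀, o₁, o₂` of the places. -/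
structure ClCurveCertE2R where
  cc : ClCurveCertE2
  sgn : List ((ℤ × ℤ × ℤ) × Bool × Bool)
  o₀ : Fin 3
  o₁ : Fin 3
  o₂ : Fin 3

namespace ClCurveCertE2R

variable (ccr : ClCurveCertE2R)

/-- Sign bit at `ρ₁` of the element with `α`-view coordinates `X` (table lookup; `false` if absent). -/
def sg₂ (X : ℤ × ℤ × ℤ) : Bool :=
  match ccr.sgn.find? fun e => e.1 == X with
  | some e => e.2.1
  | none => false

/-- Sign bit at `ρ₂` of the element with `α`-view coordinates `X` (table lookup; `false` if absent). -/
def sg₃ (X : ℤ × ℤ × ℤ) : Bool :=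
  match ccr.sgn.find? fun e => e.1 == X with
  | some e => e.2.2
  | none => false

end ClCurveCertE2R

/-! ## Checkers -/

section Checkers

variable (G : ClFieldCertRE2) (ccr : ClCurveCertE2R)

/-- **Family-entry checker (totally real)**: the complex two-view clause (`famCheckE2`, whose sign clause is the one at
`ρ₀`) and the sign clauses at `ρ₁`, `ρ₂`, all read on `X = m₁·x`. -/
def famCheckE2R (f : FamEntry2) : Bool :=
  famCheckE2 G.toE2 ccr.cc f &&
    signCond G.fre.re.lo₂ G.fre.re.hi₂ f.X (ccr.sg₂ f.X) &&
    signCond G.fre.re.lo₃ G.fre.re.hi₃ f.X (ccr.sg₃ f.X)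

/-- Sign bit of the entry `f` at place `k`. -/
def sgAt2 (f : FamEntry2) (k : Fin 3) : Bool :=
  if k = 0 then f.sg else if k = 1 then ccr.sg₂ f.X else ccr.sg₃ f.X

/-- Row `k` of the parity matrix at the entry `f`: `0, 1, 2` the signs at `ρ₀, ρ₁, ρ₂`, `3` parity of `ord_{W₁}`,
`4` parity of `ord_{W₂}`, `5 + i` the Euler bit of the `i`-th residue character (all on `X`). -/
def bitRowR2 (fc : ClFieldCert) (f : FamEntry2) : ℕ → Bool
  | 0 => f.sg
  | 1 => ccr.sg₂ f.X
  | 2 => ccr.sg₃ f.X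
  | 3 => !decide ((2 : ℤ) ∣ famL₁2 f)
  | 4 => !decide ((2 : ℤ) ∣ famL₂2 f)
  | k + 5 => eulerBit (fc.chars.getD k (3, 0, 0)).1 (evalInt (fc.chars.getD k (3, 0, 0)).2.1 f.X)

/-- The parity matrix. -/
def bitR2 (k : Fin (G.toE2.fe.base.chars.length + 5)) (j : Fin (fam2 ccr.cc).length) : Bool :=
  bitRowR2 ccr G.toE2.fe.base ((fam2 ccr.cc).get j) k

/-- **The sieve** on pairs `(T, U)` (`T = ∅`): norm-square residues modulo `Q` and the three-real-place sign
conditions in `θ_E`-order (`admStd3RQ`, norms `N(X)/m₁³`), parities of `ord_{W₁}`, `ord_{W₂}`. -/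
def admR2 (T : Finset (Fin 0)) (U : Finset (Fin (fam2 ccr.cc).length)) : Bool :=
  admStd3RQ ccr.cc.Q (fun i : Fin 0 => i.elim0) (famNorm2 G.toE2 ccr.cc) (fun i : Fin 0 => i.elim0)
      (fun i : Fin 0 => i.elim0) (fun i : Fin 0 => i.elim0)
      (fun j => sgAt2 ccr ((fam2 ccr.cc).get j) ccr.o₀) (fun j => sgAt2 ccr ((fam2 ccr.cc).get j) ccr.o₁)
      (fun j => sgAt2 ccr ((fam2 ccr.cc).get j) ccr.o₂) T U &&
    decide (Even (U.filter fun j => bitRowR2 ccr G.toE2.fe.base ((fam2 ccr.cc).get j) 3 = true).card) &&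
    decide (Even (U.filter fun j => bitRowR2 ccr G.toE2.fe.base ((fam2 ccr.cc).get j) 4 = true).card)

/-- **The totally real two-view per-curve checker for `rank ≤ r`**: the clauses of the complex checker `checkE2` with
`Δ(F) > 0`, a head of FIVE field-level elements, the three-sign family clause, the `θ_E`-order of the places read on
`X_t`, the parity certificate with `chars.length + 5` rows, and the count of sieve survivors `≤ 2 ^ r`. Computable. -/
def checkE2R (r : ℕ) : Bool :=
  decide (deltaShort ccr.cc.A ccr.cc.B ccr.cc.C ≠ 0) &&
    noRootMod ccr.cc.pF ccr.cc.A ccr.cc.B ccr.cc.C &&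
    decide (cubicAtCoords G.toE2.fe.base.a G.toE2.fe.base.b G.toE2.fe.base.c ((G.toE2.m₁ : ℤ) * ccr.cc.A)
      ((G.toE2.m₁ : ℤ) ^ 2 * ccr.cc.B) ((G.toE2.m₁ : ℤ) ^ 3 * ccr.cc.C) ccr.cc.Xt = (0, 0, 0)) &&
    decide (derivAtCoords G.toE2.fe.base.a G.toE2.fe.base.b G.toE2.fe.base.c ((G.toE2.m₁ : ℤ) * ccr.cc.A)
      ((G.toE2.m₁ : ℤ) ^ 2 * ccr.cc.B) ccr.cc.Xt =
      MonicCubic.mulCoords G.toE2.fe.base.a G.toE2.fe.base.b G.toE2.fe.base.c (smulCoords (G.toE2.m₁ : ℤ) ccr.cc.XD)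
        (prodPowCoords G.toE2.fe.base.a G.toE2.fe.base.b G.toE2.fe.base.c [])) &&
    twoViewCheck G.toE2.fe.base.a G.toE2.fe.base.b G.toE2.fe.base.c G.toE2.fe.u G.toE2.fe.d G.toE2.m₁ G.toE2.m₂
      ccr.cc.Xt ccr.cc.Yt &&
    twoViewCheck G.toE2.fe.base.a G.toE2.fe.base.b G.toE2.fe.base.c G.toE2.fe.u G.toE2.fe.d G.toE2.m₁ G.toE2.m₂
      ccr.cc.XD ccr.cc.YD &&
    decide (0 < MonicCubic.disc ccr.cc.A ccr.cc.B ccr.cc.C) &&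
    decide (normFormZ G.toE2.fe.base.a G.toE2.fe.base.b G.toE2.fe.base.c ccr.cc.XD.1 ccr.cc.XD.2.1 ccr.cc.XD.2.2 ≠ 0) &&
    decide ((normFormZ G.toE2.fe.base.a G.toE2.fe.base.b G.toE2.fe.base.c ccr.cc.XD.1 ccr.cc.XD.2.1
      ccr.cc.XD.2.2).natAbs = (ccr.cc.dn.map fun pe => pe.1 ^ pe.2).prod) &&
    (ccr.cc.dn.all fun pe => primeDispatch G.toE2 ccr.cc ccr.cc.XD ccr.cc.YD ccr.cc.dinvA ccr.cc.dinvE pe.1) &&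
    (ccr.cc.codes.all fun bc => codeClause G.toE2 ccr.cc bc) &&
    invCert G.toE2.fe.base.a G.toE2.fe.base.b G.toE2.fe.base.c G.toE2.fe.base.w₁ ccr.cc.XD ccr.cc.dW1 &&
    invCert G.toE2.fe.base.a G.toE2.fe.base.b G.toE2.fe.base.c G.toE2.fe.base.w₂ ccr.cc.XD ccr.cc.dW2 &&
    (ccr.cc.Q.all fun q => decide (0 < q)) &&
    decide (ccr.cc.head.length = 5) &&
    ((fam2 ccr.cc).all fun f => famCheckE2R G ccr f) &&
    (linLtCond (G.fre.re.I ccr.o₀).1 (G.fre.re.I ccr.o₀).2 (G.fre.re.I ccr.o₁).1 (G.fre.re.I ccr.o₁).2 ccr.cc.Xt &&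
      linLtCond (G.fre.re.I ccr.o₁).1 (G.fre.re.I ccr.o₁).2 (G.fre.re.I ccr.o₂).1 (G.fre.re.I ccr.o₂).2 ccr.cc.Xt) &&
    decide (∀ T : Finset (Fin (fam2 ccr.cc).length), T ≠ ∅ →
      ∃ k : Fin (G.toE2.fe.base.chars.length + 5), Odd (T.filter fun j => bitR2 G ccr k j = true).card) &&
    decide (((Finset.univ ×ˢ Finset.univ).filter
      (fun p : Finset (Fin 0) × Finset (Fin (fam2 ccr.cc).length) => admR2 G ccr p.1 p.2 = true)).card ≤ 2 ^ r)

end Checkers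

/-! ## Soundness -/

section Sound

variable {K : Type*} [Field K] [NumberField K] {θ : K} {F : ClFieldCertE2}

/-- **Sign of a two-view element at a real place from an interval sign clause on `X`** (`true` = negative):
`ρ(X) = m₁·ρ(x)` with `m₁ > 0`. [folklore] -/
theorem sign_iff_eltOf_of_signCond (hθ : aeval θ (MonicCubic.poly F.fe.base.a F.fe.base.b F.fe.base.c) = 0)
    (ρ : K →+* ℝ) {lo hi : ℚ} (h0 : 0 ≤ lo) (hlo : ((lo : ℚ) : ℝ) < ρ θ) (hhi : ρ θ < ((hi : ℚ) : ℝ))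
    (hE : F.fe.checkCoreE = true) (hK : F.checkConst = true) {X Y : ℤ × ℤ × ℤ}
    (htv : twoViewCheck F.fe.base.a F.fe.base.b F.fe.base.c F.fe.u F.fe.d F.m₁ F.m₂ X Y = true) {sg : Bool}
    (h : signCond lo hi X sg = true) :
    (sg = true ↔ ρ (algebraMap (𝓞 K) K (eltOf F hθ hE X Y)) < 0) := by
  have h1 := sign_iff_of_signCond hθ ρ h0 hlo hhi h
  rw [rho_eltOf hθ hE hK htv ρ] at h1
  have hm : (0 : ℝ) < F.m₁ := Nat.cast_pos.mpr (F.m₁_pos hK)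
  rw [h1]
  constructor
  · intro hneg
    by_contra hc
    push Not at hc
    nlinarith
  · intro hneg
    exact mul_neg_of_pos_of_neg hm hneg

/-- A two-view element with an interval sign clause does not vanish at the place. [folklore] -/
theorem rho_eltOf_ne_zero_of_signCond (hθ : aeval θ (MonicCubic.poly F.fe.base.a F.fe.base.b F.fe.base.c) = 0)
    (ρ : K →+* ℝ) {lo hi : ℚ} (h0 : 0 ≤ lo) (hlo : ((lo : ℚ) : ℝ) < ρ θ) (hhi : ρ θ < ((hi : ℚ) : ℝ))
    (hE : F.fe.checkCoreE = true) (hK : F.checkConst = true) {X Y : ℤ × ℤ × ℤ}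
    (htv : twoViewCheck F.fe.base.a F.fe.base.b F.fe.base.c F.fe.u F.fe.d F.m₁ F.m₂ X Y = true) {sg : Bool}
    (h : signCond lo hi X sg = true) : ρ (algebraMap (𝓞 K) K (eltOf F hθ hE X Y)) ≠ 0 := by
  have h1 := rho_lin_ne_zero_of_signCond hθ ρ h0 hlo hhi h
  rw [rho_eltOf hθ hE hK htv ρ] at h1
  exact (mul_ne_zero_iff.mp h1).2

variable {G : ClFieldCertRE2} {ccr : ClCurveCertE2R} {f : FamEntry2}

/-- The complex clause of a checked entry. -/
theorem famCheckE2_of_famCheckE2R (h : famCheckE2R G ccr f = true) : famCheckE2 G.toE2 ccr.cc f = true := by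
  simp only [famCheckE2R, Bool.and_eq_true] at h
  exact h.1.1

/-- **Sign bits at the three places** of a checked entry (`true` = negative). [folklore] -/
theorem sgAt2_iff_of_famCheckE2R
    (hθ : aeval θ (MonicCubic.poly G.toE2.fe.base.a G.toE2.fe.base.b G.toE2.fe.base.c) = 0)
    (ρ : Fin 3 → (K →+* ℝ)) (h0 : ∀ k, 0 ≤ (G.fre.re.I k).1)
    (hρ : ∀ k, (((G.fre.re.I k).1 : ℚ) : ℝ) < ρ k θ ∧ ρ k θ < (((G.fre.re.I k).2 : ℚ) : ℝ))
    (hE : G.toE2.fe.checkCoreE = true) (hK : G.toE2.checkConst = true) (h : famCheckE2R G ccr f = true)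
    (k : Fin 3) :
    (sgAt2 ccr f k = true ↔ ρ k (algebraMap (𝓞 K) K (eltOf G.toE2 hθ hE f.X f.Y)) < 0) := by
  have htv := tv_of_famCheckE2 (famCheckE2_of_famCheckE2R h)
  have h1 := signCond_of_famCheckE2 (famCheckE2_of_famCheckE2R h)
  simp only [famCheckE2R, Bool.and_eq_true] at h
  obtain ⟨⟨-, h2⟩, h3⟩ := h
  have hk0 := h0 k
  obtain ⟨hlo, hhi⟩ := hρ k
  fin_cases k <;> simp only [ClFieldCertR.I, sgAt2, Fin.isValue, Fin.zero_eta, Fin.mk_one, Fin.reduceFinMk,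
    ↓reduceIte, Fin.reduceEq] at hk0 hlo hhi ⊢
  · exact sign_iff_eltOf_of_signCond hθ _ hk0 hlo hhi hE hK htv h1
  · exact sign_iff_eltOf_of_signCond hθ _ hk0 hlo hhi hE hK htv h2
  · exact sign_iff_eltOf_of_signCond hθ _ hk0 hlo hhi hE hK htv h3

/-- A checked entry does not vanish at any place. [folklore] -/
theorem rho_ne_zero_of_famCheckE2R
    (hθ : aeval θ (MonicCubic.poly G.toE2.fe.base.a G.toE2.fe.base.b G.toE2.fe.base.c) = 0)
    (ρ : Fin 3 → (K →+* ℝ)) (h0 : ∀ k, 0 ≤ (G.fre.re.I k).1)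
    (hρ : ∀ k, (((G.fre.re.I k).1 : ℚ) : ℝ) < ρ k θ ∧ ρ k θ < (((G.fre.re.I k).2 : ℚ) : ℝ))
    (hE : G.toE2.fe.checkCoreE = true) (hK : G.toE2.checkConst = true) (h : famCheckE2R G ccr f = true)
    (k : Fin 3) : ρ k (algebraMap (𝓞 K) K (eltOf G.toE2 hθ hE f.X f.Y)) ≠ 0 := by
  have htv := tv_of_famCheckE2 (famCheckE2_of_famCheckE2R h)
  have h1 := signCond_of_famCheckE2 (famCheckE2_of_famCheckE2R h)
  simp only [famCheckE2R, Bool.and_eq_true] at h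
  obtain ⟨⟨-, h2⟩, h3⟩ := h
  have hk0 := h0 k
  obtain ⟨hlo, hhi⟩ := hρ k
  fin_cases k <;> simp only [ClFieldCertR.I, Fin.isValue, Fin.zero_eta, Fin.mk_one, Fin.reduceFinMk,
    ↓reduceIte, Fin.reduceEq] at hk0 hlo hhi ⊢
  · exact rho_eltOf_ne_zero_of_signCond hθ _ hk0 hlo hhi hE hK htv h1
  · exact rho_eltOf_ne_zero_of_signCond hθ _ hk0 hlo hhi hE hK htv h2
  · exact rho_eltOf_ne_zero_of_signCond hθ _ hk0 hlo hhi hE hK htv h3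

end Sound

end Summit.BirchSwinnertonDyer.BirchSwinnertonDyer.Rank2Observatory.TwoDescCl

end
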